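import Mathlib
import Literature.NumberTheory.Transcendental.BrumerPadicField
import Literature.NumberTheory.Transcendental.BakerLogarithmsConclusion
import HarnessLib

/-!
# Brumer's `p`-adic analogue of Baker's theorem — extrapolation and conclusion

Topic `Literature/NumberTheory/Transcendental`; namespace
`Literature.NumberTheory.Transcendental.BrumerPadic`.  Fourth support file for the proof of the
named fact `Literature.NumberTheory.Transcendental.brumer1967_thm1` (`BrumerPadicBaker.lean`;
A. Brumer, Mathematika **14** (1967), Theorem 1); sequel to `BrumerPadicSetup.lean` (auxiliary
function, `p`-adic extrapolation estimate) and `BrumerPadicField.lean` (Siegel step, `p`-adic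
arithmetic lower bound).  It ports the extrapolation induction of the tree's
`BakerLogarithmsConclusion.lean` (A. Baker, *Transcendental Number Theory*, 1975, Ch. 2,
Lemma 4, pp. 23–24) and concludes — `Setup.false_of_setup : False` for every `Setup`.

## The parameters

As in the complex file we use one large integer `k` and pure powers: `L = k^b`, points
`l·p`, `1 ≤ l ≤ P_J = k^{J+3}`, orders `D_J = 2^{T-J} k^a`, `0 ≤ J ≤ T`, here with
`b = 4n + 5`, `a = b + 4`, `T = (b+1)(n+1)` (`n + 1` logarithms), `k ≥ C₀` (the constants of
the set-up: `M`, `c_K`, `|D|`, `h`, `C_h`) and `k ≥ Kn n` (a numerical threshold).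

## The argument (Baker 1975, Ch. 2, Lemma 4, `p`-adic version; and the conclusion)

* `Setup.exists_c` — Lemma 2 for these parameters (`Setup.lemma2`, `siegel_card`);
* `Setup.vanish_succ`, `Setup.vanish_of_le` — **Lemma 4**: if `F c m (l p) = 0` for `l ≤ P_J`,
  `|m| ≤ D_J`, then also for `l ≤ P_{J+1}`, `|m| ≤ D_{J+1}`: the `p`-adic Schwarz estimate
  `‖F c m (l p)‖ ≤ ‖P_m‖ p^{-P_J D_{J+1}}` (`Setup.norm_F_natMul_le_of_vanishing`) against the
  `p`-adic Liouville bound `‖F c m (l p)‖ ≥ ‖P_m‖ (C_h H^h)⁻¹` (`Setup.norm_G_ge`), `H ≤ k^{EH}`,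
  and the exponent inequality `Etot_lt` ("untenable if `h` is sufficiently large", p. 24);
* **the conclusion** (`Setup.false_of_setup`).  In the homogeneous case no analogue of Baker's
  Lemmas 5–7 is needed: at stage `T`, `F c 0 (l p) = ∑_λ c(λ) θ_λ^l = 0` for
  `1 ≤ l ≤ P_T`, where the `θ_λ = ∏ αᵢ^{λᵢ} = exp (p ψ_λ)` are pairwise distinct (injectivity of
  the `p`-adic exponential on its ball and the linear independence of the `ℓᵢ` over `ℚ`) and
  non-zero, and `P_T ≥ #{λ}`; a Vandermonde determinant (`eq_zero_of_forall_sum_mul_pow_eq_zero`)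
  forces `c = 0`, contradicting Lemma 2.

No named facts; everything is proved.

## References

* [Brumer1967] A. Brumer, *On the units of algebraic number fields*, Mathematika 14 (1967),
  121–124, Theorem 1.
* [BakerTNT1975] A. Baker, *Transcendental Number Theory*, CUP 1975, Ch. 2, Lemma 4 (pp. 23–24)
  and §5 (pp. 26–27).
-/

noncomputable section

open NormedSpace Finset
-- the two generic `k`-power estimates are shared with the complex proof
open Literature.NumberTheory.Transcendental.Baker1975 (pow_le_kpow_mul mul_le_kpow)

namespace Literature.NumberTheory.Transcendental

namespace BrumerPadic

/-! ### The parameters -/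

/-- The exponent `b = 4n + 5` with `L = k^b`. [folklore] -/
def bb (n : ℕ) : ℕ := 4 * n + 5

/-- The exponent `a = b + 4` of the orders `D_J = 2^{T-J} k^a`. [folklore] -/
def aa (n : ℕ) : ℕ := 4 * n + 9

/-- The number `T = (b+1)(n+1)` of extrapolation steps. [folklore] -/
def TT (n : ℕ) : ℕ := (bb n + 1) * (n + 1)

/-- `L = k^b` (Baker's `L`, p. 20). [cite: BakerTNT1975, Ch. 2 §3] -/
def Lpar (n k : ℕ) : ℕ := k ^ bb n

/-- The number of points `P_J = k^{J+3}` at stage `J` (Baker's `R_J`, p. 23).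
[cite: BakerTNT1975, Ch. 2 Lemma 4] -/
def Ppar (k J : ℕ) : ℕ := k ^ (J + 3)

/-- The order `D_J = 2^{T-J} k^a` at stage `J` (Baker's `S_J = [h²/2^J]`, p. 23).
[cite: BakerTNT1975, Ch. 2 Lemma 4] -/
def Dpar (n k J : ℕ) : ℕ := 2 ^ (TT n - J) * k ^ aa n

/-- The threshold `k ≥ Kn n` on the parameter (the part of Baker's "sufficiently large `c`",
p. 19, depending only on `n`). [folklore] -/
def Kn (n : ℕ) : ℕ := 2 ^ (n * (TT n + 1) + 2) + 16 * ((bb n + 3) * (n + 2))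

/-- Exponent budget of the Siegel bound `|c(λ)| ≤ k^{EB}`. [folklore] -/
def EB (n k : ℕ) : ℕ :=
  (bb n + 1) * (n + 1) + 1 + (n * Dpar n k 0 + (n + 1) * (Lpar n k * Ppar k 0)) +
    ((bb n + 2) * (n * Dpar n k 0) + (n + 1) * (Lpar n k * Ppar k 0))

/-- Exponent budget of the house `H` in the arithmetic lower bound at stage `J`. [folklore] -/
def EH (n k J : ℕ) : ℕ :=
  (bb n + 1) * (n + 1) + EB n k + ((Dpar n k (J + 1) + (n + 1) * (Lpar n k * Ppar k (J + 1))) +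
    ((bb n + 2) * Dpar n k (J + 1) + (n + 1) * (Lpar n k * Ppar k (J + 1))))

/-- Total exponent budget `C_h H^h ≤ k^{Etot}` of the extrapolation step at stage `J`. [folklore] -/
def Etot (n k J : ℕ) : ℕ := 1 + EH n k J * k

/-- Basic consequences of `Kn n ≤ k`. [folklore] -/
theorem of_Kn_le {n k : ℕ} (hk : Kn n ≤ k) :
    2 ≤ k ∧ 2 ^ (n * (TT n + 1) + 2) ≤ k ∧ 16 * ((bb n + 3) * (n + 2)) ≤ k := by
  have h2T : 2 ^ (n * (TT n + 1) + 2) ≤ k := le_trans (Nat.le_add_right _ _) hk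
  have hQ : 16 * ((bb n + 3) * (n + 2)) ≤ k := le_trans (Nat.le_add_left _ _) hk
  refine ⟨?_, h2T, hQ⟩
  calc 2 ≤ 2 ^ (n * (TT n + 1) + 2) := by
        calc 2 = 2 ^ 1 := by norm_num
          _ ≤ 2 ^ (n * (TT n + 1) + 2) := Nat.pow_le_pow_right (by norm_num) (by omega)
    _ ≤ k := h2T

/-- **The exponent inequality behind the extrapolation step**: `k · Etot < P_J · D_{J+1}`, i.e.
`k^{Etot} ≤ 2^{k Etot} < 2^{P_J D_{J+1}} ≤ p^{P_J D_{J+1}}` — the gain of the ultrametric Schwarz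
lemma beats the arithmetic size (Baker, p. 24: "untenable if `h` is sufficiently large").
[folklore] -/
theorem Etot_lt {n k J : ℕ} (hk : Kn n ≤ k) (hJ : J < TT n) :
    Etot n k J * k < Ppar k J * Dpar n k (J + 1) := by
  obtain ⟨hk2, -, hQ⟩ := of_Kn_le hk
  have hk1 : 1 ≤ k := by omega
  set U : ℕ := Ppar k J * Dpar n k (J + 1) with hU
  have hpow : ∀ {e e' : ℕ}, e ≤ e' → k ^ e ≤ k ^ e' := fun h => Nat.pow_le_pow_right hk1 h
  have hUeq : U = 2 ^ (TT n - (J + 1)) * k ^ (aa n + J + 3) := by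
    rw [hU, Ppar, Dpar]; ring
  have hU1 : k ^ (aa n + J + 3) ≤ U := by
    rw [hUeq]; exact Nat.le_mul_of_pos_left _ (Nat.one_le_two_pow)
  -- generic term bounds
  have hK : ∀ {c e : ℕ}, 8 * c ≤ k → e + 1 ≤ aa n + J + 3 → 8 * c * k ^ e ≤ U := by
    intro c e hc he
    calc 8 * c * k ^ e ≤ k * k ^ e := Nat.mul_le_mul_right _ hc
      _ = k ^ (e + 1) := by rw [pow_succ]; ring
      _ ≤ k ^ (aa n + J + 3) := hpow he
      _ ≤ U := hU1
  have hD1 : ∀ {c : ℕ}, 8 * c ≤ k → 8 * c * (Dpar n k (J + 1) * (k * k)) ≤ U := by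
    intro c hc
    have h1 : 8 * c ≤ k ^ (J + 1) := hc.trans (by
      calc k = k ^ 1 := (pow_one k).symm
        _ ≤ k ^ (J + 1) := hpow (by omega))
    calc 8 * c * (Dpar n k (J + 1) * (k * k))
        = 2 ^ (TT n - (J + 1)) * ((8 * c) * k ^ (aa n + 2)) := by rw [Dpar]; ring
      _ ≤ 2 ^ (TT n - (J + 1)) * (k ^ (J + 1) * k ^ (aa n + 2)) := by gcongr
      _ = U := by rw [hUeq, ← pow_add]; ring_nf
  have hD0 : ∀ {c : ℕ}, 16 * c ≤ k → 8 * c * (Dpar n k 0 * (k * k)) ≤ U := by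
    intro c hc
    have hT : TT n - 0 = (TT n - (J + 1)) + (J + 1) := by omega
    have h2 : 2 ^ J ≤ k ^ J := Nat.pow_le_pow_left hk2 _
    calc 8 * c * (Dpar n k 0 * (k * k))
        = 2 ^ (TT n - (J + 1)) * ((16 * c) * 2 ^ J * k ^ (aa n + 2)) := by
          rw [Dpar, hT, pow_add, pow_succ]; ring
      _ ≤ 2 ^ (TT n - (J + 1)) * (k * k ^ J * k ^ (aa n + 2)) := by gcongr
      _ = U := by rw [hUeq]; ring
  -- the individual terms
  have c1 : 8 * (2 * ((bb n + 1) * (n + 1)) + 1) ≤ k := by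
    have : 2 * ((bb n + 1) * (n + 1)) + 1 ≤ 2 * ((bb n + 3) * (n + 2)) := by nlinarith
    omega
  have t0 : 8 * 1 * k ^ 1 ≤ U := hK (by omega) (by omega)
  have t1 : 8 * (2 * ((bb n + 1) * (n + 1)) + 1) * k ^ 2 ≤ U := hK c1 (by omega)
  have t2 : 8 * ((bb n + 3) * n) * (Dpar n k 0 * (k * k)) ≤ U :=
    hD0 (le_trans (Nat.mul_le_mul_left 16 (Nat.mul_le_mul_left _ (by omega))) hQ)
  have t3 : 8 * (2 * (n + 1)) * k ^ (bb n + 5) ≤ U := by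
    refine hK ?_ (by unfold aa bb; omega)
    have : 2 * (n + 1) ≤ (bb n + 3) * (n + 2) := by nlinarith
    omega
  have t4 : 8 * (bb n + 3) * (Dpar n k (J + 1) * (k * k)) ≤ U := by
    refine hD1 ?_
    have : bb n + 3 ≤ (bb n + 3) * (n + 2) := Nat.le_mul_of_pos_right _ (by omega)
    omega
  have t5 : 8 * (2 * (n + 1)) * k ^ (bb n + J + 6) ≤ U := by
    refine hK ?_ (by unfold aa bb; omega)
    have : 2 * (n + 1) ≤ (bb n + 3) * (n + 2) := by nlinarith
    omega
  simp only [mul_one, pow_one] at t0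
  -- algebraic identities for the structured quantities
  have eP0 : Lpar n k * Ppar k 0 = k ^ (bb n + 3) := by rw [Lpar, Ppar, ← pow_add]
  have eP1 : Lpar n k * Ppar k (J + 1) = k ^ (bb n + J + 4) := by
    rw [Lpar, Ppar, ← pow_add]; ring_nf
  have hEH : EH n k J = (2 * ((bb n + 1) * (n + 1)) + 1) + (bb n + 3) * n * Dpar n k 0 +
      2 * (n + 1) * (Lpar n k * Ppar k 0) + (bb n + 3) * Dpar n k (J + 1) +
        2 * (n + 1) * (Lpar n k * Ppar k (J + 1)) := by
    unfold EH EB; ring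
  have hUpos : 0 < U := lt_of_lt_of_le (by positivity) hU1
  have e5 : k ^ (bb n + 5) = k ^ (bb n + 3) * (k * k) := by ring
  have e6 : k ^ (bb n + J + 6) = k ^ (bb n + J + 4) * (k * k) := by ring
  have hmain : 8 * (Etot n k J * k) < 8 * U := by
    have h1 : Etot n k J * k = k + EH n k J * (k * k) := by unfold Etot; ring
    rw [h1, hEH, eP0, eP1]
    rw [e5] at t3
    rw [e6] at t5
    nlinarith [t0, t1, t2, t3, t4, t5, hUpos]
  omega

/-- **The counting condition of Siegel's lemma** for our parameters:
`2 · P₀ (D₀+1)ⁿ h ≤ (L+1)^{n+1}` once `h ≤ k` (Baker, p. 22: "`N > 2M`").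
[cite: BakerTNT1975, Ch. 2 Lemma 2] -/
theorem siegel_card {n k h : ℕ} (hk : Kn n ≤ k) (hh : h ≤ k) :
    2 * (Ppar k 0 * (Dpar n k 0 + 1) ^ n * h) ≤ (Lpar n k + 1) ^ (n + 1) := by
  obtain ⟨hk2, h2T, -⟩ := of_Kn_le hk
  have hk1 : 1 ≤ k := by omega
  have h2T1 : 2 ^ (TT n + 1) ≤ k ^ (TT n + 1) := Nat.pow_le_pow_left hk2 _
  have h1 : Dpar n k 0 + 1 ≤ 2 ^ (TT n + 1) * k ^ aa n := by
    calc Dpar n k 0 + 1 = 2 ^ TT n * k ^ aa n + 1 := by rw [Dpar, Nat.sub_zero]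
      _ ≤ 2 ^ TT n * k ^ aa n + 2 ^ TT n * k ^ aa n :=
          Nat.add_le_add_left (Nat.one_le_iff_ne_zero.mpr (by positivity)) _
      _ = 2 ^ (TT n + 1) * k ^ aa n := by rw [pow_succ]; ring
  have h2 : (Dpar n k 0 + 1) ^ n ≤ 2 ^ (n * (TT n + 1)) * k ^ (aa n * n) := by
    calc (Dpar n k 0 + 1) ^ n ≤ (2 ^ (TT n + 1) * k ^ aa n) ^ n := Nat.pow_le_pow_left h1 _
      _ = 2 ^ (n * (TT n + 1)) * k ^ (aa n * n) := by
          rw [mul_pow, ← pow_mul, ← pow_mul, mul_comm (TT n + 1) n]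
  have h3 : 2 * 2 ^ (n * (TT n + 1)) ≤ k := by
    calc 2 * 2 ^ (n * (TT n + 1)) = 2 ^ (n * (TT n + 1) + 1) := by rw [pow_succ]; ring
      _ ≤ 2 ^ (n * (TT n + 1) + 2) := Nat.pow_le_pow_right (by norm_num) (by omega)
      _ ≤ k := h2T
  have hexp : (aa n * n + 3 + 1) + 1 ≤ bb n * (n + 1) := by
    unfold bb aa; ring_nf; omega
  calc 2 * (Ppar k 0 * (Dpar n k 0 + 1) ^ n * h)
      ≤ 2 * (k ^ 3 * (2 ^ (n * (TT n + 1)) * k ^ (aa n * n)) * k) := by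
        rw [Ppar]
        gcongr
    _ = (2 * 2 ^ (n * (TT n + 1))) * k ^ (aa n * n + 3 + 1) := by ring
    _ ≤ k * k ^ (aa n * n + 3 + 1) := Nat.mul_le_mul_right _ h3
    _ = k ^ ((aa n * n + 3 + 1) + 1) := by ring
    _ ≤ k ^ (bb n * (n + 1)) := Nat.pow_le_pow_right hk1 hexp
    _ = (k ^ bb n) ^ (n + 1) := by rw [pow_mul]
    _ ≤ (Lpar n k + 1) ^ (n + 1) := Nat.pow_le_pow_left (Nat.le_succ _) _

/-- `L + 1 ≤ k^{b+1}`. [folklore] -/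
theorem Lpar_succ_le {n k : ℕ} (hk : 2 ≤ k) : Lpar n k + 1 ≤ k ^ (bb n + 1) := by
  have h1 : 1 ≤ k ^ bb n := Nat.one_le_pow _ _ (by omega)
  calc Lpar n k + 1 ≤ k ^ bb n + k ^ bb n := Nat.add_le_add_left h1 _
    _ = 2 * k ^ bb n := by ring
    _ ≤ k * k ^ bb n := Nat.mul_le_mul_right _ hk
    _ = k ^ (bb n + 1) := by rw [pow_succ]; ring

/-- **There are enough points at stage `T`**: `#[0,L]^{n+1} = (L+1)^{n+1} ≤ k^{T} ≤ P_T`.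
[folklore] -/
theorem card_Idx_le {n k : ℕ} (hk : Kn n ≤ k) :
    Fintype.card (Idx n (Lpar n k)) ≤ Ppar k (TT n) := by
  obtain ⟨hk2, -, -⟩ := of_Kn_le hk
  have hk1 : 1 ≤ k := by omega
  rw [card_Idx, Ppar]
  calc (Lpar n k + 1) ^ (n + 1) ≤ (k ^ (bb n + 1)) ^ (n + 1) := Nat.pow_le_pow_left (Lpar_succ_le hk2) _
    _ = k ^ (TT n) := by rw [← pow_mul, TT]
    _ ≤ k ^ (TT n + 3) := Nat.pow_le_pow_right hk1 (by omega)

/-! ### Real estimates in powers of `k`: `Baker1975.pow_le_kpow_mul`, `Baker1975.mul_le_kpow`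
(from `BakerLogarithmsConclusion.lean`) are used below. -/

/-! ### A Vandermonde argument -/

/-- **Vandermonde**: if `θ : ι → F` is injective with non-zero values and
`∑ᵢ cᵢ θᵢ^l = 0` for `l = 1, …, #ι`, then `c = 0` (the matrix `(θᵢ^l)` is a Vandermonde matrix
times the invertible diagonal matrix `(θᵢ)`). [folklore] -/
theorem eq_zero_of_forall_sum_mul_pow_eq_zero {ι F : Type*} [Fintype ι] [Field F]
    (θ : ι → F) (hθ : Function.Injective θ) (hθ0 : ∀ i, θ i ≠ 0) (c : ι → F)
    (h : ∀ l : ℕ, 1 ≤ l → l ≤ Fintype.card ι → ∑ i, c i * θ i ^ l = 0) : c = 0 := by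
  classical
  set N := Fintype.card ι with hN
  set e : ι ≃ Fin N := Fintype.equivFin ι with he
  set v : Fin N → F := fun j => θ (e.symm j) with hv
  have hvinj : Function.Injective v := hθ.comp e.symm.injective
  set V : Matrix (Fin N) (Fin N) F := Matrix.vandermonde v with hV
  have hdet : V.transpose.det ≠ 0 := by
    rw [Matrix.det_transpose]
    exact (Matrix.det_vandermonde_ne_zero_iff).mpr hvinj
  set d : Fin N → F := fun j => c (e.symm j) * θ (e.symm j) with hd
  have hmul : V.transpose.mulVec d = 0 := by
    funext j
    rw [Matrix.mulVec, Pi.zero_apply]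
    change ∑ i, V i j * d i = 0
    simp only [hV, Matrix.vandermonde_apply, hd]
    have h1 := h ((j : ℕ) + 1) (Nat.succ_pos _) (by have := j.isLt; omega)
    rw [← e.symm.sum_comp] at h1
    rw [← h1]
    refine sum_congr rfl fun i _ => ?_
    rw [pow_succ]
    ring
  have hd0 : d = 0 := Matrix.eq_zero_of_mulVec_eq_zero hdet hmul
  funext i
  have h1 := congrFun hd0 (e i)
  simp only [hd, Equiv.symm_apply_apply, Pi.zero_apply, mul_eq_zero] at h1
  exact h1.resolve_right (hθ0 i)

namespace Setup

variable {p : ℕ} [Fact p.Prime]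
variable {𝕂 : Type*} [NontriviallyNormedField 𝕂] [CharZero 𝕂] [NormedAlgebra ℚ_[p] 𝕂]
variable (S : Setup p 𝕂)

/-! ### The constants of the set-up and the threshold `C₀` -/

/-- The sum of the constants of the set-up (Baker's `c, c₁, c₂, …`, p. 19): the conjugate bound
`M`, the coordinate constant `c_K`, the denominator `|D|`, the degree `h` and the Liouville
constant `C_h`. [cite: BakerTNT1975, Ch. 2 §3] -/
def Cst : ℝ := S.M + S.cK + |(S.D : ℝ)| + S.h + S.Ch + 3

/-- **The threshold** `C₀ = ⌈Cst⌉`: for `k ≥ C₀` every constant of the set-up is at most `k`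
(Baker: "`h` … exceeds a sufficiently large number `c`", p. 19). [cite: BakerTNT1975, Ch. 2 §3] -/
def C₀ : ℕ := ⌈S.Cst⌉₊

/-- For `k ≥ C₀` all constants are at most `k`, and `k ≥ 3`. [folklore] -/
theorem consts_le {k : ℕ} (hk : S.C₀ ≤ k) :
    S.M ≤ k ∧ S.cK ≤ k ∧ |(S.D : ℝ)| ≤ k ∧ (S.h : ℝ) ≤ k ∧ S.Ch ≤ k ∧ (3 : ℝ) ≤ k := by
  have hC : S.Cst ≤ k := (Nat.le_ceil _).trans (by exact_mod_cast hk)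
  have h3 := S.one_le_M
  have h4 := S.one_le_cK
  have h5 := S.one_le_abs_D
  have h6 : (1 : ℝ) ≤ S.h := by exact_mod_cast S.one_le_h
  have h7 := S.one_le_Ch
  unfold Cst at hC
  refine ⟨?_, ?_, ?_, ?_, ?_, ?_⟩ <;> linarith

/-! ### The coefficients `c(λ)` (Lemma 2 for our parameters) -/

/-- The bound of Lemma 2 for the parameters `L = k^b`, `P₀ = k³`, `D₀ = 2^T k^a`
(Baker: `|p(λ)| ≤ e^{h³}`, p. 21). [cite: BakerTNT1975, Ch. 2 Lemma 2] -/
def Bp (k : ℕ) : ℝ :=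
  ((Lpar S.n k + 1 : ℕ) : ℝ) ^ (S.n + 1) * (S.cK * (|(S.D : ℝ)| ^ S.e₀ (Lpar S.n k) (Ppar k 0)
    (Dpar S.n k 0) * ((2 * (Lpar S.n k) * S.M) ^ (S.n * Dpar S.n k 0) *
      S.M ^ ((S.n + 1) * (Lpar S.n k * Ppar k 0)))))

variable [IsUltrametricDist 𝕂] [CompleteSpace 𝕂]

/-- **Vanishing at stage `J`** (statement (4) of Baker's Lemma 4, p. 23, `p`-adic points):
`F c m (l p) = 0` for all `1 ≤ l ≤ P_J` and all `|m| ≤ D_J`. [cite: BakerTNT1975, Ch. 2 Lemma 4] -/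
def Vanish (k : ℕ) (c : Idx S.n (Lpar S.n k) → ℤ) (J : ℕ) : Prop :=
  ∀ l : ℕ, 1 ≤ l → l ≤ Ppar k J → ∀ m : Fin S.n → ℕ, ∑ r, m r ≤ Dpar S.n k J →
    S.F c m ((l : 𝕂) * p) = 0

/-- **Lemma 2 for our parameters**: for `k ≥ C₀, Kn` there are integers `c(λ)`, not all zero,
`|c(λ)| ≤ Bp`, with `F c m (l p) = 0` for `1 ≤ l ≤ P₀ = k³`, `|m| ≤ D₀ = 2^T k^a`.
[cite: BakerTNT1975, Ch. 2 Lemma 2] -/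
theorem exists_c {k : ℕ} (hk : S.C₀ ≤ k) (hkn : Kn S.n ≤ k) :
    ∃ c : Idx S.n (Lpar S.n k) → ℤ, c ≠ 0 ∧ (∀ u, |(c u : ℝ)| ≤ S.Bp k) ∧ S.Vanish k c 0 := by
  obtain ⟨-, -, -, hh, -, -⟩ := S.consts_le hk
  have hh' : S.h ≤ k := by exact_mod_cast hh
  have hcard := siegel_card (n := S.n) hkn hh'
  have hk1 : 1 ≤ k := by have := (of_Kn_le hkn).1; omega
  obtain ⟨c, hc0, hB, hV⟩ := S.lemma2 (Lpar S.n k) (Ppar k 0) (Dpar S.n k 0)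
    (by unfold Ppar; exact pow_pos (by omega) _) hcard
  refine ⟨c, hc0, hB, fun l hl1 hlP m hm => hV l hl1 hlP m fun r => ?_⟩
  exact (single_le_sum (f := m) (fun j _ => Nat.zero_le _) (mem_univ r)).trans hm

omit [IsUltrametricDist 𝕂] [CompleteSpace 𝕂] in
/-- `Bp ≤ k^{EB}`. [folklore] -/
theorem Bp_le {k : ℕ} (hk : S.C₀ ≤ k) (hkn : Kn S.n ≤ k) : S.Bp k ≤ (k : ℝ) ^ EB S.n k := by
  obtain ⟨hM, hcK, hD, -, -, h3⟩ := S.consts_le hk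
  obtain ⟨hk2, -⟩ := of_Kn_le hkn
  have hk1 : (1 : ℝ) ≤ k := by linarith
  have hM1 := S.one_le_M
  -- the factors
  have f1 : ((Lpar S.n k + 1 : ℕ) : ℝ) ^ (S.n + 1) ≤ (k : ℝ) ^ ((bb S.n + 1) * (S.n + 1)) :=
    pow_le_kpow_mul (by positivity) (by exact_mod_cast Lpar_succ_le hk2)
  have f2 : S.cK ≤ (k : ℝ) ^ 1 := by rw [pow_one]; exact hcK
  have f3 : |(S.D : ℝ)| ^ S.e₀ (Lpar S.n k) (Ppar k 0) (Dpar S.n k 0) ≤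
      (k : ℝ) ^ (S.n * Dpar S.n k 0 + (S.n + 1) * (Lpar S.n k * Ppar k 0)) :=
    pow_le_pow_left₀ (abs_nonneg _) hD _
  have f4 : (2 * (Lpar S.n k : ℝ) * S.M) ^ (S.n * Dpar S.n k 0) ≤
      (k : ℝ) ^ ((bb S.n + 2) * (S.n * Dpar S.n k 0)) := by
    refine pow_le_kpow_mul (by positivity) ?_
    have h2 : (2 : ℝ) ≤ k := by exact_mod_cast hk2
    calc 2 * (Lpar S.n k : ℝ) * S.M ≤ k * (Lpar S.n k : ℝ) * k := by gcongr
      _ = (k : ℝ) ^ (bb S.n + 2) := by rw [Lpar]; push_cast; ring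
  have f6 : S.M ^ ((S.n + 1) * (Lpar S.n k * Ppar k 0)) ≤
      (k : ℝ) ^ ((S.n + 1) * (Lpar S.n k * Ppar k 0)) := pow_le_pow_left₀ (by linarith) hM _
  -- nonnegativity of the factors
  have nM : (0 : ℝ) ≤ S.M := by linarith
  have n3 : (0 : ℝ) ≤ |(S.D : ℝ)| ^ S.e₀ (Lpar S.n k) (Ppar k 0) (Dpar S.n k 0) :=
    pow_nonneg (abs_nonneg _) _
  have n4 : (0 : ℝ) ≤ (2 * (Lpar S.n k : ℝ) * S.M) ^ (S.n * Dpar S.n k 0) :=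
    pow_nonneg (mul_nonneg (mul_nonneg zero_le_two (Nat.cast_nonneg _)) nM) _
  have n6 : (0 : ℝ) ≤ S.M ^ ((S.n + 1) * (Lpar S.n k * Ppar k 0)) := pow_nonneg nM _
  have n2 : (0 : ℝ) ≤ S.cK := by linarith [S.one_le_cK]
  unfold Bp EB
  have g1 := mul_le_kpow f4 n6 f6
  have g3 := mul_le_kpow f3 (mul_nonneg n4 n6) g1
  have g4 := mul_le_kpow f2 (mul_nonneg n3 (mul_nonneg n4 n6)) g3
  have g5 := mul_le_kpow f1 (mul_nonneg n2 (mul_nonneg n3 (mul_nonneg n4 n6))) g4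
  refine g5.trans (le_of_eq ?_)
  congr 1
  ring

/-! ### Lemma 4: the extrapolation step -/

omit [IsUltrametricDist 𝕂] [CompleteSpace 𝕂] in
/-- `Bp ≥ 0` as soon as it bounds some `|c(λ)|`. [folklore] -/
theorem Bp_nonneg_of_bound {k : ℕ} {c : Idx S.n (Lpar S.n k) → ℤ}
    (hB : ∀ u, |(c u : ℝ)| ≤ S.Bp k) : 0 ≤ S.Bp k :=
  (abs_nonneg _).trans (hB default)

omit [Fact p.Prime] in
/-- `D_J = 2 D_{J+1}` for `J < T`. [folklore] -/
theorem Dpar_eq_add {n k J : ℕ} (hJ : J < TT n) :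
    Dpar n k J = Dpar n k (J + 1) + Dpar n k (J + 1) := by
  have hT : TT n - J = (TT n - (J + 1)) + 1 := by omega
  rw [Dpar, Dpar, hT, pow_succ]; ring

/-- **Baker 1975, Lemma 4 — the induction step, `p`-adically** (pp. 23–24). Suppose
`|c(λ)| ≤ Bp` and `F c m (l p) = 0` for `1 ≤ l ≤ P_J`, `|m| ≤ D_J`. Then `F c m (l p) = 0` for
`1 ≤ l ≤ P_{J+1}`, `|m| ≤ D_{J+1}`.  For such `m`, `F_m` has zeros of order `≥ D_{J+1}` at the
`P_J` points `l p`, so `‖F c m (l p)‖ ≤ ‖P_m‖ p^{-P_J D_{J+1}}` (ultrametric Schwarz,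
`norm_F_natMul_le_of_vanishing`); if `F c m (l p) ≠ 0` then `G ≠ 0` and the `p`-adic Liouville
bound `‖F c m (l p)‖ = ‖P_m‖ ‖G‖ ≥ ‖P_m‖ (C_h (max 1 H)^h)⁻¹` (`norm_G_ge`) with
`C_h (max 1 H)^h ≤ k^{Etot} ≤ 2^{k Etot} < 2^{P_J D_{J+1}} ≤ p^{P_J D_{J+1}}` (`Etot_lt`) is
contradictory. [cite: BakerTNT1975, Ch. 2 Lemma 4] -/
theorem vanish_succ {k : ℕ} (hk : S.C₀ ≤ k) (hkn : Kn S.n ≤ k) {c : Idx S.n (Lpar S.n k) → ℤ}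
    (hB : ∀ u, |(c u : ℝ)| ≤ S.Bp k) {J : ℕ} (hJ : J < TT S.n) (hV : S.Vanish k c J) :
    S.Vanish k c (J + 1) := by
  classical
  obtain ⟨hM, -, hD, hh, hCh, h3⟩ := S.consts_le hk
  obtain ⟨hk2, -, -⟩ := of_Kn_le hkn
  have hp : p.Prime := Fact.out
  have hk1 : 1 ≤ k := by omega
  have hk1r : (1 : ℝ) ≤ k := by exact_mod_cast hk1
  have hk2r : (2 : ℝ) ≤ k := by exact_mod_cast hk2
  have hk0r : (0 : ℝ) < k := by linarith
  have hM1 := S.one_le_M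
  have hCh1 := S.one_le_Ch
  have hBp0 := S.Bp_nonneg_of_bound hB
  intro l hl1 hlP m hm
  by_contra hne
  have hD₁ : Dpar S.n k J = Dpar S.n k (J + 1) + Dpar S.n k (J + 1) := Dpar_eq_add hJ
  -- nonnegativity facts
  have nM : (0 : ℝ) ≤ S.M := by linarith
  have nD : (0 : ℝ) ≤ |(S.D : ℝ)| := abs_nonneg _
  have nL : (0 : ℝ) ≤ (Lpar S.n k : ℝ) := Nat.cast_nonneg _
  have nLM : (0 : ℝ) ≤ 2 * (Lpar S.n k) * S.M := mul_nonneg (mul_nonneg zero_le_two nL) nM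
  have nL1 : (0 : ℝ) ≤ ((Lpar S.n k + 1 : ℕ) : ℝ) ^ (S.n + 1) := pow_nonneg (Nat.cast_nonneg _) _
  -- (A) the `p`-adic Schwarz upper bound for `‖F c m (l p)‖`
  have hup : ‖S.F c m ((l : 𝕂) * p)‖ ≤
      ‖S.P m‖ * ((p : ℝ)⁻¹) ^ (Ppar k J * Dpar S.n k (J + 1)) :=
    S.norm_F_natMul_le_of_vanishing c (P₀ := Ppar k J) (T := Dpar S.n k J) hV m
      (S₀ := Dpar S.n k (J + 1)) (by rw [hD₁]; omega) l
  -- (B) the arithmetic lower bound (Lemma 3, `p`-adic form)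
  have hG : S.G (Lpar S.n k) c m l ≠ 0 := by
    intro h0
    apply hne
    rw [S.F_natMul_eq, h0, map_zero, mul_zero]
  have hlow := S.norm_G_ge c hB m l hG
  -- (C) combine: `p^{P D} ≤ C_h (max 1 H)^h`
  set N : ℕ := Ppar k J * Dpar S.n k (J + 1) with hN
  set H : ℝ := ((Lpar S.n k + 1 : ℕ) : ℝ) ^ (S.n + 1) * S.Bp k *
      (|(S.D : ℝ)| ^ eD S.n (Lpar S.n k) m l * ((2 * (Lpar S.n k) * S.M) ^ (∑ r, m r) *
        S.M ^ ((S.n + 1) * ((Lpar S.n k) * l)))) with hH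
  set Y : ℝ := S.Ch * (max 1 H) ^ S.h with hY
  have hP0 : 0 < ‖S.P m‖ := norm_pos_iff.mpr (S.P_ne_zero m)
  have hFG : ‖S.F c m ((l : 𝕂) * p)‖ = ‖S.P m‖ * ‖algebraMap S.K 𝕂 (S.G (Lpar S.n k) c m l)‖ := by
    rw [S.F_natMul_eq, norm_mul]
  have hιG : ‖algebraMap S.K 𝕂 (S.G (Lpar S.n k) c m l)‖ ≤ ((p : ℝ)⁻¹) ^ N := by
    refine le_of_mul_le_mul_left ?_ hP0
    rw [← hFG]
    exact hup
  have hYpos : 0 < Y := by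
    rw [hY]
    exact mul_pos (by linarith) (pow_pos (lt_of_lt_of_le one_pos (le_max_left _ _)) _)
  have hpN : (p : ℝ) ^ N ≤ Y := by
    have h1 : Y⁻¹ ≤ ((p : ℝ)⁻¹) ^ N := hlow.trans hιG
    rw [inv_pow] at h1
    exact (inv_le_inv₀ hYpos (pow_pos (by exact_mod_cast hp.pos) _)).mp h1
  -- (D) everything on the right is a bounded power of `k`
  have eL : ((Lpar S.n k : ℕ) : ℝ) = (k : ℝ) ^ bb S.n := by rw [Lpar, Nat.cast_pow]
  have f1 : ((Lpar S.n k + 1 : ℕ) : ℝ) ^ (S.n + 1) ≤ (k : ℝ) ^ ((bb S.n + 1) * (S.n + 1)) :=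
    pow_le_kpow_mul (Nat.cast_nonneg _) (by exact_mod_cast Lpar_succ_le hk2)
  have f2 := S.Bp_le hk hkn
  have he : eD S.n (Lpar S.n k) m l ≤
      Dpar S.n k (J + 1) + (S.n + 1) * (Lpar S.n k * Ppar k (J + 1)) := by
    unfold eD
    exact Nat.add_le_add hm (Nat.mul_le_mul_left _ (Nat.mul_le_mul_left _ hlP))
  have gD : |(S.D : ℝ)| ^ eD S.n (Lpar S.n k) m l ≤
      (k : ℝ) ^ (Dpar S.n k (J + 1) + (S.n + 1) * (Lpar S.n k * Ppar k (J + 1))) :=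
    (pow_le_pow_left₀ (abs_nonneg _) hD _).trans (pow_le_pow_right₀ hk1r he)
  have f6 : (2 * (Lpar S.n k) * S.M) ^ (∑ r, m r) ≤ (k : ℝ) ^ ((bb S.n + 2) * Dpar S.n k (J + 1)) := by
    have hb : 2 * (Lpar S.n k : ℝ) * S.M ≤ (k : ℝ) ^ (bb S.n + 2) := by
      calc 2 * (Lpar S.n k : ℝ) * S.M ≤ k * (Lpar S.n k : ℝ) * k := by gcongr
        _ = (k : ℝ) ^ (bb S.n + 2) := by rw [eL]; ring
    calc (2 * (Lpar S.n k : ℝ) * S.M) ^ (∑ r, m r) ≤ ((k : ℝ) ^ (bb S.n + 2)) ^ (∑ r, m r) :=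
          pow_le_pow_left₀ nLM hb _
      _ ≤ ((k : ℝ) ^ (bb S.n + 2)) ^ Dpar S.n k (J + 1) :=
          pow_le_pow_right₀ (one_le_pow₀ hk1r) hm
      _ = (k : ℝ) ^ ((bb S.n + 2) * Dpar S.n k (J + 1)) := by rw [← pow_mul]
  have f8 : S.M ^ ((S.n + 1) * ((Lpar S.n k) * l)) ≤
      (k : ℝ) ^ ((S.n + 1) * (Lpar S.n k * Ppar k (J + 1))) :=
    (pow_le_pow_left₀ (by linarith) hM _).trans
      (pow_le_pow_right₀ hk1r (Nat.mul_le_mul_left _ (Nat.mul_le_mul_left _ hlP)))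
  have nH3 : (0 : ℝ) ≤ (2 * (Lpar S.n k) * S.M) ^ (∑ r, m r) *
      S.M ^ ((S.n + 1) * ((Lpar S.n k) * l)) := mul_nonneg (pow_nonneg nLM _) (pow_nonneg nM _)
  have nDe : (0 : ℝ) ≤ |(S.D : ℝ)| ^ eD S.n (Lpar S.n k) m l := pow_nonneg nD _
  have gH : H ≤ (k : ℝ) ^ EH S.n k J := by
    have g2 := mul_le_kpow f6 (pow_nonneg nM _) f8
    have g3 := mul_le_kpow gD nH3 g2
    have g4 := mul_le_kpow f1 hBp0 f2
    have g5 := mul_le_kpow g4 (mul_nonneg nDe nH3) g3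
    rw [hH]
    refine g5.trans (le_of_eq ?_)
    congr 1
  have gmax : max 1 H ≤ (k : ℝ) ^ EH S.n k J := max_le (one_le_pow₀ hk1r) gH
  have hh' : S.h ≤ k := by exact_mod_cast hh
  have gmaxh : (max 1 H) ^ S.h ≤ (k : ℝ) ^ (EH S.n k J * k) := by
    calc (max 1 H) ^ S.h ≤ ((k : ℝ) ^ EH S.n k J) ^ S.h :=
          pow_le_pow_left₀ (le_trans zero_le_one (le_max_left _ _)) gmax _
      _ ≤ ((k : ℝ) ^ EH S.n k J) ^ k := pow_le_pow_right₀ (one_le_pow₀ hk1r) hh'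
      _ = (k : ℝ) ^ (EH S.n k J * k) := by rw [← pow_mul]
  have gCh : S.Ch ≤ (k : ℝ) ^ 1 := by rw [pow_one]; exact hCh
  have gY : Y ≤ (k : ℝ) ^ Etot S.n k J := by
    rw [hY]
    have g1 := mul_le_kpow gCh (pow_nonneg (le_trans zero_le_one (le_max_left _ _)) _) gmaxh
    exact g1
  -- (E) `k^{Etot} ≤ 2^{k Etot} < 2^{N} ≤ p^N`, contradiction
  have h2k : (k : ℝ) ≤ (2 : ℝ) ^ k := by exact_mod_cast (Nat.lt_two_pow_self).le
  have hkE : (k : ℝ) ^ Etot S.n k J ≤ (2 : ℝ) ^ (Etot S.n k J * k) := by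
    rw [mul_comm, pow_mul]
    exact pow_le_pow_left₀ hk0r.le h2k _
  have hlt : (2 : ℝ) ^ (Etot S.n k J * k) < (2 : ℝ) ^ N :=
    pow_lt_pow_right₀ one_lt_two (Etot_lt hkn hJ)
  have h2p : (2 : ℝ) ^ N ≤ (p : ℝ) ^ N :=
    pow_le_pow_left₀ zero_le_two (by exact_mod_cast hp.two_le) _
  linarith

/-- **Baker 1975, Lemma 4** (p. 23), `p`-adically: by induction on `J ≤ T`, `F c m (l p) = 0`
for all `1 ≤ l ≤ P_J` and `|m| ≤ D_J`; the case `J = 0` is Lemma 2.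
[cite: BakerTNT1975, Ch. 2 Lemma 4] -/
theorem vanish_of_le {k : ℕ} (hk : S.C₀ ≤ k) (hkn : Kn S.n ≤ k) {c : Idx S.n (Lpar S.n k) → ℤ}
    (hB : ∀ u, |(c u : ℝ)| ≤ S.Bp k) (h0 : S.Vanish k c 0) : ∀ J ≤ TT S.n, S.Vanish k c J := by
  intro J
  induction J with
  | zero => exact fun _ => h0
  | succ J ih => exact fun hJ => S.vanish_succ hk hkn hB (by omega) (ih (by omega))

/-! ### The conclusion: distinct frequencies and a Vandermonde determinant -/

/-- The numbers `θ_λ = ∏ᵢ αᵢ^{λᵢ} = exp (p ψ_λ)`. [folklore] -/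
theorem prod_α_pow_eq_exp {L : ℕ} (u : Idx S.n L) :
    ∏ i, S.α i ^ (u i : ℕ) = exp (S.w u * (p : 𝕂)) := by
  have h := S.exp_w_mul_natMul u 1
  simp only [Nat.cast_one, one_mul, mul_one] at h
  exact h.symm

/-- The `θ_λ` are non-zero. [folklore] -/
theorem prod_α_pow_ne_zero {L : ℕ} (u : Idx S.n L) : ∏ i, S.α i ^ (u i : ℕ) ≠ 0 := by
  rw [S.prod_α_pow_eq_exp]
  exact PadicExp.exp_ne_zero (ℓ := p) (norm_mul_lt_of_norm_le_one (S.norm_w_lt u)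
    (IwasawaLog.norm_natCast_le_one p (F := 𝕂) p))

/-- **The `θ_λ` are pairwise distinct**: `exp` is injective on its ball and
`ψ_λ = ψ_λ'` forces `λ = λ'` by the linear independence of the `ℓᵢ` over `ℚ` (Baker, p. 26:
"the `ψ_λ` are distinct"). [cite: BakerTNT1975, Ch. 2 §5] -/
theorem prod_α_pow_injective {L : ℕ} :
    Function.Injective fun u : Idx S.n L => ∏ i, S.α i ^ (u i : ℕ) := by
  intro u v huv
  change ∏ i, S.α i ^ (u i : ℕ) = ∏ i, S.α i ^ (v i : ℕ) at huv
  rw [S.prod_α_pow_eq_exp, S.prod_α_pow_eq_exp] at huv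
  have hp1 : ‖(p : 𝕂)‖ ≤ 1 := IwasawaLog.norm_natCast_le_one p (F := 𝕂) p
  have h1 : S.w u * (p : 𝕂) = S.w v * (p : 𝕂) :=
    PadicExp.exp_injOn (ℓ := p) (norm_mul_lt_of_norm_le_one (S.norm_w_lt u) hp1)
      (norm_mul_lt_of_norm_le_one (S.norm_w_lt v) hp1) huv
  have hp0 : (p : 𝕂) ≠ 0 := by exact_mod_cast (Fact.out : p.Prime).ne_zero
  have h2 : S.w u = S.w v := mul_right_cancel₀ hp0 h1
  -- linear independence over `ℚ`
  have h3 : ∑ i, ((((u i : ℕ) : ℚ) - ((v i : ℕ) : ℚ)) • S.ℓ i) = 0 := by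
    have e : ∀ i, ((((u i : ℕ) : ℚ) - ((v i : ℕ) : ℚ)) • S.ℓ i) =
        ((u i : ℕ) : 𝕂) * S.ℓ i - ((v i : ℕ) : 𝕂) * S.ℓ i := by
      intro i
      rw [Algebra.smul_def, map_sub, map_natCast, map_natCast, sub_mul]
    simp_rw [e]
    rw [sum_sub_distrib]
    change S.w u - S.w v = 0
    rw [h2, sub_self]
  have h4 := Fintype.linearIndependent_iff.mp S.linearIndependent _ h3
  funext i
  have h5 := h4 i
  rw [sub_eq_zero] at h5
  exact Fin.ext (by exact_mod_cast h5)

/-- At stage `T`, for `m = 0`: `∑_λ c(λ) θ_λ^l = 0` for `1 ≤ l ≤ P_T`. [cite: BakerTNT1975, Ch. 2 §5] -/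
theorem sum_mul_prod_pow_eq_zero {k : ℕ} {c : Idx S.n (Lpar S.n k) → ℤ}
    (hV : S.Vanish k c (TT S.n)) {l : ℕ} (hl1 : 1 ≤ l) (hl : l ≤ Ppar k (TT S.n)) :
    ∑ u, (c u : 𝕂) * (∏ i, S.α i ^ (u i : ℕ)) ^ l = 0 := by
  have h := hV l hl1 hl 0 (by simp)
  rw [S.F_natMul] at h
  have hP : S.P 0 = 1 := by simp [Setup.P]
  rw [hP, one_mul] at h
  rw [← h]
  refine sum_congr rfl fun u _ => ?_
  congr 1
  rw [← Finset.prod_pow]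
  simp only [Pi.zero_apply, pow_zero, prod_const_one, one_mul]
  exact prod_congr rfl fun i _ => by rw [← pow_mul]

/-- **Brumer's theorem, the normalised case: there is no `Setup`** (Baker 1975, Ch. 2,
§§3–5, `p`-adically; Brumer 1967, Theorem 1).  With `k ≥ C₀, Kn`: Lemma 2 gives `c ≠ 0` with
`F c m (l p) = 0` for `l ≤ k³`, `|m| ≤ 2^T k^a`; Lemma 4 extrapolates to `l ≤ P_T`, `m = 0`;
then `∑ c(λ) θ_λ^l = 0` for `1 ≤ l ≤ P_T`, `P_T ≥ #{λ}`, with distinct non-zero `θ_λ`, so `c = 0`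
by a Vandermonde determinant. [cite: Brumer1967, Theorem 1] [cite: BakerTNT1975, Ch. 2 §5] -/
theorem false_of_setup (S : Setup p 𝕂) : False := by
  classical
  -- the parameter `k`
  obtain ⟨k, hk, hkn⟩ : ∃ k : ℕ, S.C₀ ≤ k ∧ Kn S.n ≤ k :=
    ⟨max S.C₀ (Kn S.n), le_max_left _ _, le_max_right _ _⟩
  -- Lemmas 2 and 4
  obtain ⟨c, hc0, hB, hV0⟩ := S.exists_c hk hkn
  have hVT := S.vanish_of_le hk hkn hB hV0 (TT S.n) le_rfl
  -- the Vandermonde argument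
  have hcard : Fintype.card (Idx S.n (Lpar S.n k)) ≤ Ppar k (TT S.n) := card_Idx_le hkn
  have hsum : ∀ l : ℕ, 1 ≤ l → l ≤ Fintype.card (Idx S.n (Lpar S.n k)) →
      ∑ u, (c u : 𝕂) * (∏ i, S.α i ^ (u i : ℕ)) ^ l = 0 :=
    fun l hl1 hl2 => S.sum_mul_prod_pow_eq_zero hVT hl1 (hl2.trans hcard)
  have hc := eq_zero_of_forall_sum_mul_pow_eq_zero (fun u : Idx S.n (Lpar S.n k) =>
    ∏ i, S.α i ^ (u i : ℕ)) S.prod_α_pow_injective S.prod_α_pow_ne_zero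
    (fun u => (c u : 𝕂)) hsum
  apply hc0
  funext u
  have h1 := congrFun hc u
  simp only [Pi.zero_apply, Int.cast_eq_zero] at h1
  exact h1

end Setup

end BrumerPadic

end Literature.NumberTheory.Transcendental

end
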